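import Literature.NumberTheory.EllipticCurves.RootNumberTableThreeLocalBridgeProofs
import HarnessLib

/-!
# Rizzo's Table II, column Kod: the Kodaira symbol on each row (bookkeeping on the transcription)

`Proofs` file (theorems only; no definition, no named fact) in topic
`NumberTheory/EllipticCurves`, companion of `RootNumberTableThree` (the transcription `Rizzo.tableII`
of O. G. Rizzo, Compositio Math. 136 (2003), Table II; that file is untouched) and twin of
`RootNumberTableThreeCondExpRowsProofs` (the `v(N)` column), first file of the kernel proof that the
Kod column of Table II is the Kodaira symbol of Tate's algorithm (cell `b2b-bsdres`, team n1011,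
ROW T-PAP3-KOD; the gap recorded in `RootNumberTableThree` under "What is NOT here": "any proof that
`W.tableKodairaSymbolThree` is the tree's `W.kodairaSymbolAt v`").  For each of the 24 printed rows —
in the shape in which Tate's algorithm produces them (`TateAlgorithm.rowDatum_of_minimal`: exact
entries as numerals, "`≥ k`" entries as an arbitrary `a : WithTop ℤ` with
`KellockDokchitser.atLeast a k`, the special conditions as the value of the corresponding `decide`) —
the Kod entry `(Rizzo.tableII …).1` is computed by unfolding the `if`-cascade (pure evaluation;
nothing about curves).  Also the two readings of `Rizzo.kodairaOfInvariants` on the LOCAL reduced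
triple (shift `0`, and shift `1` for the two ★ rows), twins of
`Rizzo.condExpOfInvariants_eq_of_shift_zero` / `…_one` of `RootNumberTableThreeLocalReadingsProofs`.

## References

* O. G. Rizzo, *Average root numbers for a nonconstant family of elliptic curves*, Compositio
  Math. 136 (2003) 1–23, §1.1–1.2 (pp. 3–4) and Table II (p. 4), column Kod. [Rizzo2003]
* I. Papadopoulos, *Sur la classification de Néron des courbes elliptiques en caractéristique
  résiduelle 2 et 3*, J. Number Theory 44 (1993) 119–152, Table III (`p = 3`). [Papadopoulos1993]
-/

namespace Literature.NumberTheory.EllipticCurves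

namespace Rizzo

open Literature.NumberTheory.DiophantineGeometry (KodairaSymbol)

/-! ### Rows read with exact entries -/

/-- Row `(0,0,0)`: Kodaira symbol `I₀`. [cite: Rizzo2003, Table II (p. 4), column Kod] -/
theorem kodaira_row_0_0_0 (x y z : ℤ) : (tableII 0 0 0 x y z).1 = .I 0 := by
  unfold tableII; dsimp only
  simp (config := { decide := true }) only [ite_true, ite_false, false_and, and_false]

/-- Row `(1,≥3,0)`: Kodaira symbol `I₀`. [cite: Rizzo2003, Table II (p. 4), column Kod] -/
theorem kodaira_row_1_ge3_0 {b : WithTop ℤ} (hb : KellockDokchitser.atLeast b 3 = true)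
    (hb0 : b ≠ 0) (x y z : ℤ) : (tableII 1 b 0 x y z).1 = .I 0 := by
  unfold tableII; dsimp only
  simp (config := { decide := true }) only [ite_true, ite_false, true_and, false_and, and_false,
    and_true, hb, hb0]

/-- Row `(0,0,≥1)`: Kodaira symbol `I_c` (multiplicative reduction). [cite: Rizzo2003, Table II (p. 4), column Kod] -/
theorem kodaira_row_0_0_pos {c : ℤ} (hc : 1 ≤ c) (x y z : ℤ) :
    (tableII 0 0 c x y z).1 = .I c.toNat := by
  unfold tableII; dsimp only
  have hc0 : c ≠ 0 := by omega
  simp (config := { decide := true }) only [ite_true, ite_false, false_and, and_false,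
    and_true, hc, hc0]

/-- Row `(≥2,3,3)` WITHOUT the special condition: Kodaira symbol `II`. [cite: Rizzo2003, Table II (p. 4), column Kod] -/
theorem kodaira_row_ge2_3_3_of_not_sp {a : WithTop ℤ} (ha : KellockDokchitser.atLeast a 2 = true)
    (x y z : ℤ) (hsp : decide ((y ^ 2 + 2) % 9 = 3 * c4e a x 2 % 9) = false) :
    (tableII a 3 3 x y z).1 = .II := by
  unfold tableII; dsimp only
  simp (config := { decide := true }) only [ite_true, ite_false, false_and, and_false,
    and_true, ha, hsp]

/-- Row `(≥2,3,3)` WITH the special condition: Kodaira symbol `III`. [cite: Rizzo2003, Table II (p. 4), column Kod] -/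
theorem kodaira_row_ge2_3_3_of_sp {a : WithTop ℤ} (ha : KellockDokchitser.atLeast a 2 = true)
    (x y z : ℤ) (hsp : decide ((y ^ 2 + 2) % 9 = 3 * c4e a x 2 % 9) = true) :
    (tableII a 3 3 x y z).1 = .III := by
  unfold tableII; dsimp only
  simp (config := { decide := true }) only [ite_true, ite_false, false_and, and_false,
    and_true, ha, hsp]

/-- Row `(2,4,3)`: Kodaira symbol `II`. [cite: Rizzo2003, Table II (p. 4), column Kod] -/
theorem kodaira_row_2_4_3 (x y z : ℤ) : (tableII 2 4 3 x y z).1 = .II := by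
  unfold tableII; dsimp only
  simp (config := { decide := true }) only [ite_true, ite_false, true_and, false_and, and_false]

/-- Row `(2,3,4)`: Kodaira symbol `II`. [cite: Rizzo2003, Table II (p. 4), column Kod] -/
theorem kodaira_row_2_3_4 (x y z : ℤ) : (tableII 2 3 4 x y z).1 = .II := by
  unfold tableII; dsimp only
  simp (config := { decide := true }) only [ite_true, ite_false, false_and, and_false]

/-- Row `(≥3,4,5)`: Kodaira symbol `II`. [cite: Rizzo2003, Table II (p. 4), column Kod] -/
theorem kodaira_row_ge3_4_5 {a : WithTop ℤ} (ha : KellockDokchitser.atLeast a 3 = true)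
    (ha2 : a ≠ 2) (x y z : ℤ) : (tableII a 4 5 x y z).1 = .II := by
  unfold tableII; dsimp only
  simp (config := { decide := true }) only [ite_true, ite_false, false_and, and_false,
    and_true, ha, ha2]

/-- Row `(2,≥5,3)`: Kodaira symbol `III`. [cite: Rizzo2003, Table II (p. 4), column Kod] -/
theorem kodaira_row_2_ge5_3 {b : WithTop ℤ} (hb : KellockDokchitser.atLeast b 5 = true)
    (hb3 : b ≠ 3) (hb4 : b ≠ 4) (hb2 : b ≠ 2) (x y z : ℤ) : (tableII 2 b 3 x y z).1 = .III := by
  unfold tableII; dsimp only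
  simp (config := { decide := true }) only [ite_true, ite_false, true_and, false_and, and_false,
    and_true, hb, hb2, hb3, hb4]

/-- Row `(2,3,5)`: Kodaira symbol `IV`. [cite: Rizzo2003, Table II (p. 4), column Kod] -/
theorem kodaira_row_2_3_5 (x y z : ℤ) : (tableII 2 3 5 x y z).1 = .IV := by
  unfold tableII; dsimp only
  simp (config := { decide := true }) only [ite_true, ite_false, false_and, and_false]

/-- Row `(3,5,6)`: Kodaira symbol `IV`. [cite: Rizzo2003, Table II (p. 4), column Kod] -/
theorem kodaira_row_3_5_6 (x y z : ℤ) : (tableII 3 5 6 x y z).1 = .IV := by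
  unfold tableII; dsimp only
  simp (config := { decide := true }) only [ite_true, ite_false, false_and, and_false]

/-- Row `(≥4,5,7)`: Kodaira symbol `IV`. [cite: Rizzo2003, Table II (p. 4), column Kod] -/
theorem kodaira_row_ge4_5_7 {a : WithTop ℤ} (ha : KellockDokchitser.atLeast a 4 = true)
    (x y z : ℤ) : (tableII a 5 7 x y z).1 = .IV := by
  unfold tableII; dsimp only
  simp (config := { decide := true }) only [ite_true, ite_false, false_and, and_false,
    and_true, ha]

/-- Rows `(2,3,≥6)`: Kodaira symbol `I*_{c−6}`. [cite: Rizzo2003, Table II (p. 4), column Kod] -/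
theorem kodaira_row_2_3_ge6 {c : ℤ} (hc : 6 ≤ c) (x y z : ℤ) :
    (tableII 2 3 c x y z).1 = .Istar (c - 6).toNat := by
  unfold tableII; dsimp only
  have hc3 : c ≠ 3 := by omega
  have hc4 : c ≠ 4 := by omega
  have hc5 : c ≠ 5 := by omega
  simp (config := { decide := true }) only [ite_true, ite_false, true_and, false_and, and_false,
    and_true, hc, hc3, hc4, hc5]

/-- Row `(3,≥6,6)`: Kodaira symbol `I₀*`. [cite: Rizzo2003, Table II (p. 4), column Kod] -/
theorem kodaira_row_3_ge6_6 {b : WithTop ℤ} (hb : KellockDokchitser.atLeast b 6 = true)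
    (hb4 : b ≠ 4) (hb5 : b ≠ 5) (x y z : ℤ) : (tableII 3 b 6 x y z).1 = .Istar 0 := by
  unfold tableII; dsimp only
  simp (config := { decide := true }) only [ite_true, ite_false, false_and, and_false,
    and_true, hb, hb4, hb5]

/-- Row `(≥4,6,9)` WITH the special condition: Kodaira symbol `III*`. [cite: Rizzo2003, Table II (p. 4), column Kod] -/
theorem kodaira_row_ge4_6_9_of_sp {a : WithTop ℤ} (ha : KellockDokchitser.atLeast a 4 = true)
    (x y z : ℤ) (hsp : decide ((y ^ 2 + 2) % 9 = 3 * c4e a x 4 % 9) = true) :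
    (tableII a 6 9 x y z).1 = .IIIstar := by
  unfold tableII; dsimp only
  simp (config := { decide := true }) only [ite_true, ite_false, true_and, false_and, and_false,
    and_true, ha, hsp]

/-- Row `(4,6,9)` WITHOUT the special condition: Kodaira symbol `IV*`. [cite: Rizzo2003, Table II (p. 4), column Kod] -/
theorem kodaira_row_4_6_9_of_not_sp (x y z : ℤ)
    (hsp : decide ((y ^ 2 + 2) % 9 = 3 * c4e 4 x 4 % 9) = false) :
    (tableII 4 6 9 x y z).1 = .IVstar := by
  unfold tableII; dsimp only
  simp (config := { decide := true }) only [ite_true, ite_false, true_and, false_and, and_false,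
    and_true, hsp]

/-- Row `(≥5,6,9)` with the CORRECTED special condition `c₆' ≢ ±4 (9)`: Kodaira symbol `IV*`.
[cite: Rizzo2003, Table II (p. 4)] [cite: Varillyalvarado2011, Rem. 4.2 (row (≥5,6,9) corrected)] -/
theorem kodaira_row_ge5_6_9_of_not_sp {a : WithTop ℤ} (ha : KellockDokchitser.atLeast a 5 = true)
    (ha4 : a ≠ 4) (x y z : ℤ) (hsp : decide ((y ^ 2 + 2) % 9 = 3 * c4e a x 4 % 9) = false)
    (hy : ¬ (y % 9 = 4 ∨ y % 9 = 5)) : (tableII a 6 9 x y z).1 = .IVstar := by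
  unfold tableII; dsimp only
  simp (config := { decide := true }) only [ite_true, ite_false, false_and, and_false,
    and_true, ha, ha4, hsp, hy, not_false_eq_true]

/-- Row `(4,7,9)`: Kodaira symbol `IV*`. [cite: Rizzo2003, Table II (p. 4), column Kod] -/
theorem kodaira_row_4_7_9 (x y z : ℤ) : (tableII 4 7 9 x y z).1 = .IVstar := by
  unfold tableII; dsimp only
  simp (config := { decide := true }) only [ite_true, ite_false, true_and, false_and, and_false]

/-- Row `(4,6,10)`: Kodaira symbol `IV*`. [cite: Rizzo2003, Table II (p. 4), column Kod] -/
theorem kodaira_row_4_6_10 (x y z : ℤ) : (tableII 4 6 10 x y z).1 = .IVstar := by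
  unfold tableII; dsimp only
  simp (config := { decide := true }) only [ite_true, ite_false, false_and, and_false]

/-- Row `(≥5,7,11)`: Kodaira symbol `IV*`. [cite: Rizzo2003, Table II (p. 4), column Kod] -/
theorem kodaira_row_ge5_7_11 {a : WithTop ℤ} (ha : KellockDokchitser.atLeast a 5 = true)
    (ha4 : a ≠ 4) (x y z : ℤ) : (tableII a 7 11 x y z).1 = .IVstar := by
  unfold tableII; dsimp only
  simp (config := { decide := true }) only [ite_true, ite_false, false_and, and_false,
    and_true, ha, ha4]

/-- Row `(4,≥8,9)`: Kodaira symbol `III*`. [cite: Rizzo2003, Table II (p. 4), column Kod] -/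
theorem kodaira_row_4_ge8_9 {b : WithTop ℤ} (hb : KellockDokchitser.atLeast b 8 = true)
    (hb6 : b ≠ 6) (hb7 : b ≠ 7) (x y z : ℤ) : (tableII 4 b 9 x y z).1 = .IIIstar := by
  unfold tableII; dsimp only
  simp (config := { decide := true }) only [ite_true, ite_false, true_and, false_and, and_false,
    and_true, hb, hb6, hb7]

/-- Row `(4,6,11)`: Kodaira symbol `II*`. [cite: Rizzo2003, Table II (p. 4), column Kod] -/
theorem kodaira_row_4_6_11 (x y z : ℤ) : (tableII 4 6 11 x y z).1 = .IIstar := by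
  unfold tableII; dsimp only
  simp (config := { decide := true }) only [ite_true, ite_false, false_and, and_false]

/-- Row ★`(1,2,0)` (reduced triple of a minimal `(5,8,12)`): Kodaira symbol `II*`.
[cite: Rizzo2003, Table II (p. 4)] -/
theorem kodaira_row_1_2_0 (x y z : ℤ) : (tableII 1 2 0 x y z).1 = .IIstar := by
  unfold tableII; dsimp only
  simp (config := { decide := true }) only [ite_true, ite_false, false_and, and_false]

/-- Row ★`(≥2,2,1)` (reduced triple of a minimal `(≥6,8,13)`): Kodaira symbol `II*`.
[cite: Rizzo2003, Table II (p. 4)] -/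
theorem kodaira_row_ge2_2_1 {a : WithTop ℤ} (ha : KellockDokchitser.atLeast a 2 = true)
    (ha0 : a ≠ 0) (ha1 : a ≠ 1) (x y z : ℤ) : (tableII a 2 1 x y z).1 = .IIstar := by
  unfold tableII; dsimp only
  simp (config := { decide := true }) only [ite_true, ite_false, false_and, and_false,
    and_true, ha, ha0, ha1]

/-! ### `Rizzo.kodairaOfInvariants` on the local reduced triple -/

/-- **Table II, column Kod, on the local reduced triple, shift `0`.**  If the valuations of the
rational invariants are the local ones shifted by `(4, 6, 12)·(−k)` and the local triple `(a, b, c)`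
is already reduced (`KellockDokchitser.shift c b a = 0`), then `Rizzo.kodairaOfInvariants c₄ c₆ Δ`
is the Kod entry of Table II at `(a, b, c)` with the residues of the rational invariants.
[cite: Rizzo2003, §1.1–1.2 (pp. 3–4) and Table II (p. 4), column Kod] -/
theorem kodairaOfInvariants_eq_of_shift_zero {q₄ q₆ qΔ : ℚ} {a b : WithTop ℤ} {c k : ℤ}
    (h4 : val3 q₄ = a.map fun m => m - 4 * k) (h6 : val3 q₆ = b.map fun m => m - 6 * k)
    (hΔ : padicValRat 3 qΔ = c - 12 * k) (hs : KellockDokchitser.shift c b a = 0) :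
    kodairaOfInvariants q₄ q₆ qΔ = (tableII a b c (res9 q₄) (res9 q₆) (res9 qΔ)).1 := by
  unfold kodairaOfInvariants
  rw [ofInvariants_eq_tableII_of_val3 h4 h6 hΔ, hs]
  have e4 : a.map (fun m : ℤ => m - 4 * 0) = a := by cases a with | top => rfl | coe n => simp
  have e6 : b.map (fun m : ℤ => m - 6 * 0) = b := by cases b with | top => rfl | coe n => simp
  rw [e4, e6]
  simp

/-- **Table II, column Kod, on the local reduced triple, shift `1`** (the ★ rows `(5,8,12)`,
`(≥6,8,13)` of type II*, whose minimal equation is one rescaling away from the reduced triple).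
[cite: Rizzo2003, §1.1–1.2 (pp. 3–4) and Table II (p. 4), column Kod] -/
theorem kodairaOfInvariants_eq_of_shift_one {q₄ q₆ qΔ : ℚ} {a b : WithTop ℤ} {c k : ℤ}
    (h4 : val3 q₄ = a.map fun m => m - 4 * k) (h6 : val3 q₆ = b.map fun m => m - 6 * k)
    (hΔ : padicValRat 3 qΔ = c - 12 * k) (hs : KellockDokchitser.shift c b a = 1) :
    kodairaOfInvariants q₄ q₆ qΔ =
      (tableII (a.map fun m => m - 4) (b.map fun m => m - 6) (c - 12)
        (res9 q₄) (res9 q₆) (res9 qΔ)).1 := by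
  unfold kodairaOfInvariants
  rw [ofInvariants_eq_tableII_of_val3 h4 h6 hΔ, hs]
  simp

end Rizzo

end Literature.NumberTheory.EllipticCurves
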